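import Summits.MatrixMultiplication.OmegaCensus.SmallFormats.MatMul22nRankGF7XCapMethodLimitS8
import HarnessLib

/-!
# ω-census family (a): the X-cap counting instrument over `𝔽₇` is exhausted at every slack in `⟨7, 8⟩` (in particular every `s ≥ 42`)

Cell `pub-omega` (unit `pub-omega-tensor-g9`), topic `Summits/MatrixMultiplication/OmegaCensus` (sub-folder `SmallFormats`).
Framing (verbatim): lottery ticket; floor = certified bounds/negative ranges. HONEST FRAMING: no rank bound; census bookkeeping,
the `𝔽₇` twin of `MatMul22nRankGF5XCapMethodLimitSemigroup`. The rows of `xcapSys7s s` have slack-independent columns (`col7`) and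
right-hand sides `s·(1, 2, 0)` (`rhs7s`), so feasible points add (`feasible_xcapSys7s_add`). With the slack-`7` point of
`MatMul22nRankGF7XCapMethodLimit` (total `364`) and the slack-`8` point of `MatMul22nRankGF7XCapMethodLimitS8` (total `416`) every
`s = 7a + 8b` carries a feasible point of `xcapSys7s s` in `[0, s]` with total `52·s` = the LP value, hence
(`BoxCert.Cert.sum_lt_of_check_root`) **no `BoxCert` certificate for `xcapSys7s s` passes at any `T ≤ 52·s`**
(`xcapSys7s_check_false_of_repr`); every `s ≥ 42` is of that form (`xcapSys7s_check_false_of_fortytwo_le`). Since excluding `3n + s`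
products needs a certificate at `T = 3n + s + 1 ≤ 52 s + 1` exactly when `n ≤ 17 s`, and `51·R ≥ 156·n` (`MatMul22nRankFiniteField`)
already gives `R ≥ 3n + s + 1` for `n ≥ 17 s + 1`, the instrument yields nothing beyond the LP theorem at these slacks. What remains
possible over `𝔽₇`: `s ∈ {2 (landed: n ≥ 33), 3, 4, 5, 6, 9, …, 13, 17, …, 20, 25, 26, 27, 33, 34, 41}` (cell note
`pub-omega-tensor-g9/METHOD-LIMIT.md` §7). Nothing here is progress on `ω`.
-/

namespace Summit.MatrixMultiplication.OmegaCensus.SmallFormats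

open Finset

/-! ## Additivity of feasible points over `𝔽₇` -/

/-- The coefficient matrix of `xcapSys7s s` does not depend on `s`. -/
theorem xcapSys7s_A_indep (s t r j : ℕ) : (xcapSys7s s).A r j = (xcapSys7s t).A r j := rfl

/-- The right-hand sides are additive in the slack. -/
theorem rhs7s_add (s t r : ℕ) : rhs7s (s + t) r = rhs7s s r + rhs7s t r := by
  unfold rhs7s; push_cast; split_ifs <;> ring

/-- **Feasible points add.** -/
theorem feasible_xcapSys7s_add {s t : ℕ} {x y : ℕ → ℕ} (hx : (xcapSys7s s).Feasible x) (hy : (xcapSys7s t).Feasible y) :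
    (xcapSys7s (s + t)).Feasible (fun j => x j + y j) := by
  intro r hr
  have h1 := hx r hr
  have h2 := hy r hr
  change ∑ j ∈ range 401, (xcapSys7s s).A r j * (x j : ℤ) ≤ rhs7s s r at h1
  change ∑ j ∈ range 401, (xcapSys7s t).A r j * (y j : ℤ) ≤ rhs7s t r at h2
  change ∑ j ∈ range 401, (xcapSys7s (s + t)).A r j * ((x j + y j : ℕ) : ℤ) ≤ rhs7s (s + t) r
  rw [rhs7s_add]
  have e : ∑ j ∈ range 401, (xcapSys7s (s + t)).A r j * ((x j + y j : ℕ) : ℤ)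
      = ∑ j ∈ range 401, (xcapSys7s s).A r j * (x j : ℤ) + ∑ j ∈ range 401, (xcapSys7s t).A r j * (y j : ℤ) := by
    rw [← sum_add_distrib]
    refine sum_congr rfl fun j _ => ?_
    rw [xcapSys7s_A_indep (s + t) s r j, xcapSys7s_A_indep t s r j]
    push_cast; ring
  rw [e]
  exact add_le_add h1 h2

/-- The zero point is feasible at slack `0`. -/
theorem feasible_xcapSys7s_zero : (xcapSys7s 0).Feasible (fun _ => 0) := by
  intro r hr
  change ∑ j ∈ range 401, (xcapSys7s 0).A r j * ((0 : ℕ) : ℤ) ≤ rhs7s 0 r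
  simp only [Nat.cast_zero, mul_zero, sum_const_zero]
  unfold rhs7s; split_ifs <;> simp

/-- Multiples of a feasible point are feasible at the multiplied slack. -/
theorem feasible_xcapSys7s_nsmul {s : ℕ} {x : ℕ → ℕ} (hx : (xcapSys7s s).Feasible x) (n : ℕ) :
    (xcapSys7s (n * s)).Feasible (fun j => n * x j) := by
  induction n with
  | zero => simpa using feasible_xcapSys7s_zero
  | succ n ih =>
    have h := feasible_xcapSys7s_add ih hx
    have e1 : n * s + s = (n + 1) * s := by ring
    rw [e1] at h
    convert h using 2 with j
    ring

/-! ## Every slack `s = 7a + 8b` -/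

/-- The combined point `a·(slack-7 point) + b·(slack-8 point)`. -/
def xcapWit7comb (a b : ℕ) (j : ℕ) : ℕ := a * xcapWit7s7 j + b * xcapWit7s8 j

/-- It is feasible at slack `7a + 8b`. -/
theorem xcapWit7comb_feasible (a b : ℕ) : (xcapSys7s (7 * a + 8 * b)).Feasible (xcapWit7comb a b) := by
  have h7 := feasible_xcapSys7s_nsmul xcapWit7s7_feasible a
  have h8 := feasible_xcapSys7s_nsmul xcapWit7s8_feasible b
  have h := feasible_xcapSys7s_add h7 h8
  have e : a * 7 + b * 8 = 7 * a + 8 * b := by ring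
  rw [e] at h
  exact h

/-- It lies in the box `[0, 7a + 8b]`. -/
theorem xcapWit7comb_le (a b : ℕ) : ∀ j, xcapWit7comb a b j ≤ 7 * a + 8 * b := by
  intro j
  have e1 : a * xcapWit7s7 j ≤ a * 7 := Nat.mul_le_mul_left a (xcapWit7s7_le j)
  have e2 : b * xcapWit7s8 j ≤ b * 8 := Nat.mul_le_mul_left b (xcapWit7s8_le j)
  unfold xcapWit7comb
  omega

/-- Its total is the LP value `52·(7a + 8b)`. -/
theorem xcapWit7comb_sum (a b : ℕ) : ∑ j ∈ range 401, xcapWit7comb a b j = 52 * (7 * a + 8 * b) := by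
  unfold xcapWit7comb
  rw [sum_add_distrib, ← mul_sum, ← mul_sum, xcapWit7s7_sum, xcapWit7s8_sum]
  ring

/-- **METHOD LIMIT at every slack `s = 7a + 8b` over `𝔽₇`**: no `BoxCert` certificate for `xcapSys7s s` passes at a target `T ≤ 52·s`. -/
theorem xcapSys7s_check_false_of_repr {s : ℕ} (a b : ℕ) (hs : s = 7 * a + 8 * b)
    (cert : BoxCert.Cert) (D T : ℕ) (hT : T ≤ 52 * s) : cert.check (xcapSys7s s) D T s [] = false := by
  subst hs
  exact xcapSys7s_check_false_of_point (xcapWit7comb a b) (xcapWit7comb_le a b) (xcapWit7comb_feasible a b)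
    (by rw [xcapWit7comb_sum]; exact hT) cert D

/-- **Every slack `s ≥ 42`** over `𝔽₇`: no certificate at `T ≤ 52·s` (every `s ≥ 42` is `7a + 8b`). -/
theorem xcapSys7s_check_false_of_fortytwo_le {s : ℕ} (hs : 42 ≤ s) (cert : BoxCert.Cert) (D T : ℕ) (hT : T ≤ 52 * s) :
    cert.check (xcapSys7s s) D T s [] = false :=
  xcapSys7s_check_false_of_repr ((s - 8 * (s % 7)) / 7) (s % 7) (by omega) cert D T hT

end Summit.MatrixMultiplication.OmegaCensus.SmallFormats
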